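import Summits.ResolutionOfSingularities.ResolutionOfSingularities.Theorems.SharpStrataDefs
import Literature.AlgebraicGeometry.Resolution.Blowups
import Literature.AlgebraicGeometry.Resolution.NormalizationOfVarieties
import HarnessLib

/-!
# Route SharpStrata — crux `SepExcModels` (stmt-ResolutionOfSingularities-16828): the vocabulary of
# the Kolchin phase (Defs)

Objects posited by the route (D-0016 `<Route><Crux>Defs.lean`; no new mathematics), named ONCE so
that the prover files of the crux `SharpStrata.SepExcModels` (line `registered` =
`Cruxes/SepExcModels/Lines/birth.lean`) can state lemmas about them without copying the
forty-line predicate of the Theses file: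

* `SepExcAt Y ζ` — VERBATIM the body of the `let`-bound predicate `SepExc` of
  `Summit.ResolutionOfSingularities.ResolutionOfSingularities.Theses.SharpStrata.SepExcModels`:
  `𝒪_{Y,ζ}` regular, or `ζ` closed, or a finitely generated birational local model
  `B = 𝒪_{Y,ζ}[s] ⊆ K(Y)` with a prime `𝔮` over `m_ζ`, `B_𝔮` regular and `B/𝔮` generically
  smooth over `κ(ζ)` (Benito–Piltant–Reguera 2022, Prop. 4.3 (1) / Thm. 4.4: a generically smooth
  prime divisor over `ζ`); the route-level predicate `SharpStrata.SepExc Y` of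
  `Theorems/SharpStrataDefs.lean` (landed by the sibling crux `ResSepExc`) is `∀ ζ, SepExcAt Y ζ`
  DEFINITIONALLY (`sepExc_iff_forall_sepExcAt : … := Iff.rfl`), so nothing is duplicated and
  `SepExc X'` IS the last conjunct of the crux.
* `sharpLocus Y = {ζ | ¬ SepExcAt Y ζ}` (BPR's sharp points, valuative form) and its
  specialisation-closure `sharpCentre Y = {y | ∃ ζ ∈ sharpLocus Y, ζ ⤳ y}` ("the sharp strata",
  the centre of the Kolchin step).
* `IsKolchinStep π` — `π : Y⁺ ⟶ Y` is, up to an isomorphism of the source, the normalization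
  (`Literature…Resolution.normalization`) of a blow-up (`Literature…Resolution.IsBlowup`, universal
  property) of `Y` along the vanishing ideal sheaf (Mathlib `Scheme.IdealSheafData.vanishingIdeal`)
  of the closed sharp centre.
* `KVariety k` — integral schemes with a separated quasi-compact structure morphism locally of
  finite type to `Spec k` (the hypotheses of the crux, bundled), and the Kolchin-successor relation
  `KolchinRel k V⁺ V` (`V` has a sharp point and `V⁺ ⟶ V` is a Kolchin step over `k`), whose
  accessibility is termination of the Kolchin phase (BPR Question 6.6 for the canonical process).

Sources: A. Benito, O. Piltant, A. J. Reguera, *Small irreducible components of arc spaces in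
positive characteristic*, JPAA 226 (2022) 107110, Def. 4.1–4.2, Prop. 4.3, Thm. 4.4, Question 6.6
[BenitoPiltantReguera2022]. Deliberately NOT here: arc schemes, BPR's arc-sharpness (Def. 4.1),
any statement about termination.
-/

noncomputable section

-- single-problem summit: the doubled namespace component `ResolutionOfSingularities` is forced
set_option linter.dupNamespace false

open CategoryTheory AlgebraicGeometry TopologicalSpace Topology
open Literature.AlgebraicGeometry.Resolution

namespace Summit.ResolutionOfSingularities.ResolutionOfSingularities.Theorems.SepExcModels

/-! ## The route's predicate, verbatim, and the sharp locus -/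

/-- **Separably exceptional at `ζ`** — VERBATIM the body of the `let`-bound predicate `SepExc`
of the route file (`SharpStrata.SepExcModels`): `𝒪_{Y,ζ}` is regular, or `ζ` is a closed
point, or some finitely generated birational local model `B = 𝒪_{Y,ζ}[s] ⊆ K(Y)` has a prime
`𝔮` over `m_ζ` with `B_𝔮` regular and `B/𝔮` generically smooth over `κ(ζ)` (Benito–Piltant–
Reguera 2022, Prop. 4.3 / Thm. 4.4: a prime divisor over `ζ` with separably generated residue
field, which makes `Y` arc-blunt at `ζ`). [cite: BenitoPiltantReguera2022, Prop. 4.3, Thm. 4.4] -/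
def SepExcAt (Y : Scheme.{0}) [IsIntegral Y] (ζ : Y) : Prop :=
  IsRegularLocalRing (Y.presheaf.stalk ζ) ∨ IsClosed ({ζ} : Set Y) ∨ ∃ (s : Finset Y.functionField) (𝔮 : Ideal (Algebra.adjoin (Y.presheaf.stalk ζ) (s : Set Y.functionField))) (_ : 𝔮.IsPrime) (hle : IsLocalRing.maximalIdeal (Y.presheaf.stalk ζ) ≤ 𝔮.comap (algebraMap (Y.presheaf.stalk ζ) (Algebra.adjoin (Y.presheaf.stalk ζ) (s : Set Y.functionField)))), IsRegularLocalRing (Localization.AtPrime 𝔮) ∧ ∃ g : Algebra.adjoin (Y.presheaf.stalk ζ) (s : Set Y.functionField), g ∉ 𝔮 ∧ (letI := ((algebraMap _ (Localization.Away (Ideal.Quotient.mk 𝔮 g))).comp (Ideal.quotientMap 𝔮 (algebraMap (Y.presheaf.stalk ζ) (Algebra.adjoin (Y.presheaf.stalk ζ) (s : Set Y.functionField))) hle)).toAlgebra; Algebra.Smooth (Y.presheaf.stalk ζ ⧸ IsLocalRing.maximalIdeal (Y.presheaf.stalk ζ)) (Localization.Away (Ideal.Quotient.mk 𝔮 g)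))

/-- The **sharp locus**: the points at which `Y` is not separably exceptional (non-regular,
non-closed points over which every prime divisor has inseparable residue field extension —
BPR's (valuatively) sharp points). [cite: BenitoPiltantReguera2022, Def. 4.1, Thm. 4.4] -/
def sharpLocus (Y : Scheme.{0}) [IsIntegral Y] : Set Y :=
  {ζ | ¬ SepExcAt Y ζ}

/-- The **sharp centre** = the specialisation-closure of the sharp locus = the union of the
closures of the (maximal) sharp points — "the sharp strata", the centre of the Kolchin step.
It is closed iff the sharp locus has finitely many maximal points (`stub_sharpFinite`).
[cite: BenitoPiltantReguera2022, Prop. 2.1 and Question 6.6] -/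
def sharpCentre (Y : Scheme.{0}) [IsIntegral Y] : Set Y :=
  {y | ∃ ζ ∈ sharpLocus Y, ζ ⤳ y}

/-! ## The Kolchin step and the Kolchin-successor relation -/

/-- `π : Y⁺ ⟶ Y` **is a Kolchin step**: the sharp centre of `Y` is closed, and `π` is (up to an
isomorphism of the source) the normalization of a blow-up `β : B ⟶ Y` of `Y` along the
vanishing (reduced) ideal sheaf of the sharp centre — "blow up the closures of the maximal
sharp points with reduced structure, then normalise" (card `blunt-or-sharp-kolchin-models`,
centre rule (1); BPR Question 6.6). [cite: BenitoPiltantReguera2022, Question 6.6] -/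
def IsKolchinStep {Y' Y : Scheme.{0}} [IsIntegral Y] (π : Y' ⟶ Y) : Prop :=
  ∃ (hS : IsClosed (sharpCentre Y)) (B : Scheme.{0}) (β : B ⟶ Y) (_ : IsIntegral B)
    (e : Y' ≅ normalization B),
    IsBlowup β (Scheme.IdealSheafData.vanishingIdeal ⟨sharpCentre Y, hS⟩) ∧
      e.hom ≫ normalizationι B ≫ β = π

/-- A **variety over `k`** for the purpose of the Kolchin phase: an integral scheme with a
separated, quasi-compact structure morphism locally of finite type to `Spec k` (exactly the
hypotheses of the crux on `X`, bundled so that termination can be stated as accessibility of a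
relation). [folklore] -/
structure KVariety (k : Type) [Field k] : Type 1 where
  /-- the underlying scheme -/
  X : Scheme.{0}
  /-- it is integral -/
  [isIntegral : IsIntegral X]
  /-- the structure morphism -/
  hom : X ⟶ Spec (.of k)
  /-- separated -/
  [isSeparated : IsSeparated hom]
  /-- locally of finite type -/
  [locallyOfFiniteType : LocallyOfFiniteType hom]
  /-- quasi-compact -/
  [quasiCompact : QuasiCompact hom]

attribute [instance] KVariety.isIntegral KVariety.isSeparated KVariety.locallyOfFiniteType
  KVariety.quasiCompact

/-- The **Kolchin-successor relation** on varieties over `k`: `KolchinRel k V⁺ V` iff `V` has a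
sharp point and there is a Kolchin step `V⁺ ⟶ V` over `k`. Termination of the Kolchin phase
= well-foundedness (accessibility) of this relation. [cite: BenitoPiltantReguera2022, Question 6.6] -/
def KolchinRel (k : Type) [Field k] (V' V : KVariety k) : Prop :=
  (sharpLocus V.X).Nonempty ∧ ∃ π : V'.X ⟶ V.X, π ≫ V.hom = V'.hom ∧ IsKolchinStep π

/-- The route-level predicate `SharpStrata.SepExc` (`Theorems/SharpStrataDefs.lean`, verbatim the
`let SepExc` of the route items) is, DEFINITIONALLY, "separably exceptional at every point".
[folklore] -/
theorem sepExc_iff_forall_sepExcAt (Y : Scheme.{0}) [IsIntegral Y] :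
    SharpStrata.SepExc Y ↔ ∀ ζ : Y, SepExcAt Y ζ :=
  Iff.rfl

/-- The sharp locus is the complement of the separably exceptional locus. [folklore] -/
theorem mem_sharpLocus_iff (Y : Scheme.{0}) [IsIntegral Y] (ζ : Y) :
    ζ ∈ sharpLocus Y ↔ ¬ SepExcAt Y ζ :=
  Iff.rfl

/-- The sharp locus is contained in the sharp centre (every point specialises to itself).
[folklore] -/
theorem sharpLocus_subset_sharpCentre (Y : Scheme.{0}) [IsIntegral Y] :
    sharpLocus Y ⊆ sharpCentre Y :=
  fun ζ hζ => ⟨ζ, hζ, specializes_rfl⟩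

/-- A variety without sharp points is separably exceptional (this is the definition).
[folklore] -/
theorem sepExc_of_sharpLocus_eq_empty {Y : Scheme.{0}} [IsIntegral Y]
    (h : sharpLocus Y = ∅) : SharpStrata.SepExc Y := by
  intro ζ
  by_contra hζ
  have : ζ ∈ sharpLocus Y := hζ
  rw [h] at this
  exact this

end Summit.ResolutionOfSingularities.ResolutionOfSingularities.Theorems.SepExcModels

end
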